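import Literature.MathematicalPhysics.QuantumFieldTheory.Balaban1983to89.B4Strip

/-!
# Bałaban [CMP 95 (1984)] (1.83)/(1.89) at `U = 1`: the ORDER-TWO derivative weight of the free
diagonal has **NO uniform η-rate over the Brillouin zone** — a scale-free witness (obstruction note for
the η-rate of `∇G∇*`, `∇∇G`, `G∇*∇*`; linear theory, exact rational values, no conditionals)

HONEST FRAMING (cell `pub-balaban`, T⁴ programme, estimate NE2 = U1a «η-rate, linear theory»).  This small
module records ONE elementary, kernel-checked OBSTRUCTION about lattice symbols on a FINITE torus with
`η = 1/n` and the trivial background `U = 1`: the weight `|∂^{(n)}_{μ₁}(q)|²/Δ^{(n)}(q)` — the symbol that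
multiplies the free diagonal `δ_{ll′}` of Bałaban's (1.83) ([Balaban1984PropagatorsI] p. 31) inside the
order-two items `∇G∇*` (and, up to a phase, `∇∇G`, `G∇*∇*`) of Prop. 1.1 (1.89) p. 33 — takes the values
`4/7` at level `n = N` and `2/3` at level `n = 2N` at ONE AND THE SAME physical momentum `q` of the zone
(`|q_μ| ≤ πN`), for EVERY `N`.  So, unlike the order-zero diagonal (`|Δ^{(N)}(q)⁻¹ − Δ^{(RN)}(q)⁻¹| ≤
(π²/24)N⁻²` uniformly in `q`, `B5G183Rate.inv_DeltaXir_sub_abs`, King's (4.31)) and unlike the operator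
`G` itself (`B5G183RateOp.opNorm_G_rate`, `O(1/N)`), the order-two weighted symbol admits no η-rate that is
uniform over the alias classes: the discrepancy sits at the cut-off scale `‖q‖_∞ = πN` of the coarse
lattice and is a function of `q/N` only.  Nothing here is infinite-volume, a mass gap, uniform in a
coupling, or progress on any Clay problem or on the summit statement of this programme; nothing here says
that any PRINTED statement fails — Bałaban prints NO η-rate for `G`, and King's rates ([King1986] §4) are
for kernels carrying averaging operators and «enough negative powers of momentum».  It is a typed census
item for the cell's residual (R9.i‴) (rates of the derivative sandwiches): such a rate must carry
averaging factors, a low-momentum restriction, or a loss.  All theorems `[folklore]`; `[cite: …]` tags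
locate TEXT, never a proof; the witness and its values are ours.

WHAT IS PRINTED (renders read as images by this seat: [Balaban1984PropagatorsI] p. 33; [King1986] p. 672).
Bałaban p. 33: «Proposition 1.1. The operator G is a symmetric operator on L²(T_η) and ‖GJ‖, ‖∇GJ‖,
‖G∇*J‖, ‖∇G∇*J‖, ‖∇∇GJ‖, ‖G∇*∇*J‖ ≤ γ₀⁻¹‖J‖, (1.89) with a positive constant γ₀ independent of k, T_η,
and depending on d only (if we put a = 1).»  King p. 672: «To analyze the `m = 0` term in (4.19), we
successively replace each factor by the corresponding one … and bound the error. We must always be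
careful to keep enough negative powers of momentum so that» (the alias sums converge, p. 673).

WHAT IS TYPED HERE (`B4Strip.Sxir n x = n²(2 − 2cos(x/n)) = |∂^{(n)}(x)|²` — b05's
`B5Prop11Fiber.norm_dSym_sq : ‖dSym n k s μ‖² = Sxir n ((p′+2πk)_μ)` —, `B4Strip.DeltaXir n 0 q = Σ_μ
Sxir n (q_μ) = Δ^{(n)}(q)`; two distinct directions `μ₁ ≠ μ₂`, so `d ≥ 2`):
 * the four exact values `S^{(N)}(πN) = 4N²`, `S^{(N)}(2πN/3) = 3N²`, `S^{(2N)}(πN) = 8N²`,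
   `S^{(2N)}(2πN/3) = 4N²` (`cos π`, `cos(2π/3)`, `cos(π/2)`, `cos(π/3)`);
 * the witness momentum `qWit N = (πN at μ₁, 2πN/3 at μ₂, 0 elsewhere)`, in the zone (`qWit_mem_zone`),
   at the cut-off (`qWit_at_cutoff`); `Δ^{(n)}(qWit N) = S^{(n)}(πN) + S^{(n)}(2πN/3)`;
 * `weight_level : S^{(N)}(q_{μ₁})/Δ^{(N)}(q) = 4/7` and `weight_level_double : S^{(2N)}(q_{μ₁})/Δ^{(2N)}(q)
   = 2/3` at `q = qWit N`, every `N ≥ 1`; **`order_two_weight_no_rate`: the difference is exactly `2/21`,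
   independently of `N`**;
 * the same on b05's index data (`order_two_weight_no_rate_classes`): along `N = 6m+3` the witness is the
   `B4Strip.shiftr`-representative `p′ + 2πk` of the class `kWit = (3m+1, 2m+1, 0, …)` over the NONZERO
   zone fibre `p′ = sWit = (π, 0, …, 0)` at level `N`, and of the class with the same integer coordinates
   at level `2N` (King's `m = 0` pairing: equal representatives) — so the obstruction concerns the very
   fibres `s ≠ 0` of b05's `balabanFiber`.
 Hypotheses: `1 ≤ N` (resp. none), `μ₁ ≠ μ₂`; NO conditional of the cell (no BetaPertH/(B)/(B^μ)).

WHAT IS NOT CLAIMED: (i) any statement about the full sandwich matrices `D_{∂}G D_{∂}^*` of b05 (the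
finite-rank part of (1.83) is not evaluated at the witness; the obstruction is the free-diagonal WEIGHT,
which is the entire fibre entry only up to the finite-rank corrections — their size at the witness is not
bounded below here); (ii) any lower bound on an operator norm; (iii) anything at order ≤ 1 (where the
weights are rate-compatible: `|S^{(N)}(x) − S^{(RN)}(x)| ≤ x⁴/(12N²)`, `B5G183Rate.Sxir_sub_le_quartic`,
costs one power of `|x| ≤ πN` per power of `N`) — the order-1 sandwich rates are the open residual
(R9.i‴), not touched here; (iv) `U ≠ 1`, the later papers.
-/

noncomputable section

namespace Literature.MathematicalPhysics.QuantumFieldTheory.Balaban1983to89.B5G183RateObstruction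

open scoped BigOperators
open Finset
open Literature.MathematicalPhysics.QuantumFieldTheory.Balaban1983to89.B4Strip

variable {d : ℕ}

/-- `S^{(n)}(0) = 0`. [folklore] -/
theorem Sxir_zero (n : ℕ) : Sxir n 0 = 0 := by
  simp [Sxir]

/-- `S^{(N)}(πN) = 4N²` (`cos π = −1`). [folklore] -/
theorem Sxir_pi_mul (N : ℕ) (hN : 1 ≤ N) : Sxir N (Real.pi * N) = 4 * (N : ℝ) ^ 2 := by
  have hN0 : (N : ℝ) ≠ 0 := by exact_mod_cast (Nat.one_le_iff_ne_zero.mp hN)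
  unfold Sxir
  rw [mul_div_assoc, div_self hN0, mul_one, Real.cos_pi]
  ring

/-- `S^{(N)}(2πN/3) = 3N²` (`cos(2π/3) = −1/2`). [folklore] -/
theorem Sxir_two_pi_mul_div_three (N : ℕ) (hN : 1 ≤ N) :
    Sxir N (2 * Real.pi * N / 3) = 3 * (N : ℝ) ^ 2 := by
  have hN0 : (N : ℝ) ≠ 0 := by exact_mod_cast (Nat.one_le_iff_ne_zero.mp hN)
  have hc : Real.cos (2 * Real.pi * N / 3 / N) = -1 / 2 := by
    rw [show 2 * Real.pi * N / 3 / N = 2 * (Real.pi / 3) by field_simp]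
    rw [Real.cos_two_mul, Real.cos_pi_div_three]
    norm_num
  unfold Sxir
  rw [hc]
  ring

/-- `S^{(2N)}(πN) = 8N²` (`cos(π/2) = 0`). [folklore] -/
theorem Sxir_two_mul_pi_mul (N : ℕ) (hN : 1 ≤ N) :
    Sxir (2 * N) (Real.pi * N) = 8 * (N : ℝ) ^ 2 := by
  have hN0 : (N : ℝ) ≠ 0 := by exact_mod_cast (Nat.one_le_iff_ne_zero.mp hN)
  have hc : Real.cos (Real.pi * N / ((2 * N : ℕ) : ℝ)) = 0 := by
    rw [show Real.pi * N / ((2 * N : ℕ) : ℝ) = Real.pi / 2 by push_cast; field_simp]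
    exact Real.cos_pi_div_two
  unfold Sxir
  rw [hc]
  push_cast
  ring

/-- `S^{(2N)}(2πN/3) = 4N²` (`cos(π/3) = 1/2`). [folklore] -/
theorem Sxir_two_mul_two_pi_mul_div_three (N : ℕ) (hN : 1 ≤ N) :
    Sxir (2 * N) (2 * Real.pi * N / 3) = 4 * (N : ℝ) ^ 2 := by
  have hN0 : (N : ℝ) ≠ 0 := by exact_mod_cast (Nat.one_le_iff_ne_zero.mp hN)
  have hc : Real.cos (2 * Real.pi * N / 3 / ((2 * N : ℕ) : ℝ)) = 1 / 2 := by
    rw [show 2 * Real.pi * N / 3 / ((2 * N : ℕ) : ℝ) = Real.pi / 3 by push_cast; field_simp]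
    exact Real.cos_pi_div_three
  unfold Sxir
  rw [hc]
  push_cast
  ring

/-- the witness momentum `q = (πN at μ₁, 2πN/3 at μ₂, 0 elsewhere)` — an alias point of the
fibre `p′ = (π, 0, …, 0)` at every level `N ≡ 3 (mod 6)` and of `p′ = 0` at `6 ∣ N`
(`q_{μ₁} = πN = π + 2π·(N−1)/2`, `q_{μ₂} = 2π·(N/3)`); as a physical momentum it is the same point
for the levels `N` and `2N` (King's `m = 0` pairing). [folklore] -/
def qWit (N : ℕ) (μ₁ μ₂ : Fin d) : Fin d → ℝ :=
  fun μ => if μ = μ₁ then Real.pi * N else if μ = μ₂ then 2 * Real.pi * N / 3 else 0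

/-- `Δ^{(n)}(q) = S^{(n)}(πN) + S^{(n)}(2πN/3)` at the witness (the other coordinates vanish).
[folklore] -/
theorem DeltaXir_qWit (n N : ℕ) {μ₁ μ₂ : Fin d} (hne : μ₁ ≠ μ₂) :
    DeltaXir n 0 (qWit N μ₁ μ₂) = Sxir n (Real.pi * N) + Sxir n (2 * Real.pi * N / 3) := by
  unfold DeltaXir
  rw [add_zero, ← Finset.add_sum_erase _ _ (Finset.mem_univ μ₁),
    ← Finset.add_sum_erase _ _ (Finset.mem_erase.mpr ⟨hne.symm, Finset.mem_univ μ₂⟩)]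
  have h1 : Sxir n (qWit N μ₁ μ₂ μ₁) = Sxir n (Real.pi * N) := by simp [qWit]
  have h2 : Sxir n (qWit N μ₁ μ₂ μ₂) = Sxir n (2 * Real.pi * N / 3) := by simp [qWit, hne.symm]
  have h3 : ∑ μ ∈ (Finset.univ.erase μ₁).erase μ₂, Sxir n (qWit N μ₁ μ₂ μ) = 0 := by
    refine Finset.sum_eq_zero fun μ hμ => ?_
    have hμ2 : μ ≠ μ₂ := (Finset.mem_erase.mp hμ).1
    have hμ1 : μ ≠ μ₁ := (Finset.mem_erase.mp (Finset.mem_erase.mp hμ).2).1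
    simp [qWit, hμ1, hμ2, Sxir_zero]
  rw [h1, h2, h3, add_zero]

/-- **level `N`: the order-2 free-diagonal weight `|∂_{μ₁}(q)|²/Δ(q)` equals `4/7` at the witness.**
[folklore] -/
theorem weight_level (N : ℕ) (hN : 1 ≤ N) {μ₁ μ₂ : Fin d} (hne : μ₁ ≠ μ₂) :
    Sxir N (qWit N μ₁ μ₂ μ₁) / DeltaXir N 0 (qWit N μ₁ μ₂) = 4 / 7 := by
  have hN0 : (N : ℝ) ≠ 0 := by exact_mod_cast (Nat.one_le_iff_ne_zero.mp hN)
  have h1 : Sxir N (qWit N μ₁ μ₂ μ₁) = Sxir N (Real.pi * N) := by simp [qWit]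
  rw [h1, DeltaXir_qWit N N hne, Sxir_pi_mul N hN, Sxir_two_pi_mul_div_three N hN]
  field_simp
  ring

/-- **level `2N`: the same weight at the same physical momentum equals `2/3`.** [folklore] -/
theorem weight_level_double (N : ℕ) (hN : 1 ≤ N) {μ₁ μ₂ : Fin d} (hne : μ₁ ≠ μ₂) :
    Sxir (2 * N) (qWit N μ₁ μ₂ μ₁) / DeltaXir (2 * N) 0 (qWit N μ₁ μ₂) = 2 / 3 := by
  have hN0 : (N : ℝ) ≠ 0 := by exact_mod_cast (Nat.one_le_iff_ne_zero.mp hN)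
  have h1 : Sxir (2 * N) (qWit N μ₁ μ₂ μ₁) = Sxir (2 * N) (Real.pi * N) := by simp [qWit]
  rw [h1, DeltaXir_qWit (2 * N) N hne, Sxir_two_mul_pi_mul N hN,
    Sxir_two_mul_two_pi_mul_div_three N hN]
  field_simp
  ring

/-- **NO UNIFORM η-RATE AT ORDER TWO.** For every `d ≥ 2` (two distinct directions `μ₁ ≠ μ₂`) and
EVERY `N ≥ 1`, the order-2 free-diagonal weight `|∂^{(n)}_{μ₁}(q)|²/Δ^{(n)}(q)` of Bałaban's (1.83)
(the symbol multiplying `δ_{ll′}` in the fibre of `∇_{μ₁} G ∇*_{μ₁}`, b05's sandwich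
`D_{∂_{μ₁}} G D^*_{∂_{μ₁}}` — `‖dSym n k s μ‖² = Sxir n (q_μ)` by `B5Prop11Fiber.norm_dSym_sq`) differs
between the levels `n = N` and `n = 2N` AT THE SAME PHYSICAL MOMENTUM `q = qWit N` (an alias point of
the zone, `|q_μ| ≤ πN`) by EXACTLY `2/21`, independently of `N`: the discrepancy is scale-free
(`q/N` fixed), so `sup_q |w^{(N)}(q) − w^{(RN)}(q)| ↛ 0` — contrast the order-0 diagonal, where
`|Δ^{(N)}(q)⁻¹ − Δ^{(RN)}(q)⁻¹| ≤ (π²/24)N⁻²` UNIFORMLY in `q` (`B5G183Rate.inv_DeltaXir_sub_abs`).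
Consequence for the cell's residual (R9.i‴): an η-rate for the order-2 items of (1.89)
(`∇G∇*`, `∇∇G`, `G∇*∇*`) cannot hold uniformly over the alias classes at the pure symbol level; any
such statement needs King's averaging factors / «enough negative powers of momentum» (p. 672) or a
low-momentum restriction. [cite: King1986, p.672 («We must always be careful to keep enough negative
powers of momentum»)] [folklore] -/
theorem order_two_weight_no_rate (N : ℕ) (hN : 1 ≤ N) {μ₁ μ₂ : Fin d} (hne : μ₁ ≠ μ₂) :
    |Sxir N (qWit N μ₁ μ₂ μ₁) / DeltaXir N 0 (qWit N μ₁ μ₂)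
        - Sxir (2 * N) (qWit N μ₁ μ₂ μ₁) / DeltaXir (2 * N) 0 (qWit N μ₁ μ₂)| = 2 / 21 := by
  rw [weight_level N hN hne, weight_level_double N hN hne]
  norm_num [abs_of_neg]

/-- the witness lies in the zone of level `N`: `|q_μ| ≤ πN` for every `μ`. [folklore] -/
theorem qWit_mem_zone (N : ℕ) (μ₁ μ₂ μ : Fin d) : |qWit N μ₁ μ₂ μ| ≤ Real.pi * N := by
  have hπ := Real.pi_pos.le
  have hN : (0 : ℝ) ≤ N := Nat.cast_nonneg N
  unfold qWit
  split_ifs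
  · rw [abs_of_nonneg (by positivity)]
  · rw [abs_of_nonneg (by positivity)]
    nlinarith
  · rw [abs_zero]; positivity

/-- the witness is NOT a small momentum: `‖q‖_∞ = πN` — the obstruction lives at the cut-off scale of
the coarse lattice, where the two lattice Laplacians genuinely differ. [folklore] -/
theorem qWit_at_cutoff (N : ℕ) (μ₁ μ₂ : Fin d) : qWit N μ₁ μ₂ μ₁ = Real.pi * N := by
  simp [qWit]

/-! ## The witness is a genuine alias point of a NONZERO fibre at both levels -/

/-- the fibre `p′ = (π at μ₁, 0 elsewhere)` — nonzero, in the zone. [folklore] -/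
def sWit (μ₁ : Fin d) : Fin d → ℝ := fun μ => if μ = μ₁ then Real.pi else 0

/-- the alias class `k = (3m+1 at μ₁, 2m+1 at μ₂, 0 elsewhere)` at a level `n ≥ 6m+3`. [folklore] -/
def kWit (m n : ℕ) (hn : 6 * m + 3 ≤ n) (μ₁ μ₂ : Fin d) : Fin d → Fin n :=
  fun μ => if μ = μ₁ then ⟨3 * m + 1, by omega⟩ else if μ = μ₂ then ⟨2 * m + 1, by omega⟩
    else ⟨0, by omega⟩

/-- `sWit` lies in the zone and is nonzero. [folklore] -/
theorem sWit_zone_ne_zero (μ₁ : Fin d) : (∀ μ, |sWit μ₁ μ| ≤ Real.pi) ∧ sWit μ₁ ≠ 0 := by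
  refine ⟨fun μ => ?_, fun h => ?_⟩
  · unfold sWit
    split_ifs
    · rw [abs_of_pos Real.pi_pos]
    · rw [abs_zero]; exact Real.pi_pos.le
  · have := congrFun h μ₁
    simp [sWit, Real.pi_ne_zero] at this

/-- at level `N = 6m+3` the witness momentum is the `B4Strip.shiftr`-representative of the class
`kWit` over the fibre `sWit`: `qWit N = p′ + 2πk`. [folklore] -/
theorem qWit_eq_shiftr (m : ℕ) {μ₁ μ₂ : Fin d} (hne : μ₁ ≠ μ₂) :
    qWit (6 * m + 3) μ₁ μ₂ = shiftr (6 * m + 3) (kWit m (6 * m + 3) le_rfl μ₁ μ₂) (sWit μ₁) := by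
  funext μ
  unfold qWit shiftr kWit sWit
  by_cases h1 : μ = μ₁
  · simp only [h1, if_true]
    push_cast; ring
  · by_cases h2 : μ = μ₂
    · simp only [h2, hne.symm, if_true, if_false]
      push_cast; ring
    · simp only [h1, h2, if_false]
      push_cast; ring

/-- at the doubled level `2N = 12m+6` the SAME physical momentum is the representative of the class with
the same integer coordinates over the same fibre (King's `m = 0` pairing of alias classes). [folklore] -/
theorem qWit_eq_shiftr_double (m : ℕ) {μ₁ μ₂ : Fin d} (hne : μ₁ ≠ μ₂) :
    qWit (6 * m + 3) μ₁ μ₂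
      = shiftr (2 * (6 * m + 3)) (kWit m (2 * (6 * m + 3)) (by omega) μ₁ μ₂) (sWit μ₁) := by
  funext μ
  unfold qWit shiftr kWit sWit
  by_cases h1 : μ = μ₁
  · simp only [h1, if_true]
    push_cast; ring
  · by_cases h2 : μ = μ₂
    · simp only [h2, hne.symm, if_true, if_false]
      push_cast; ring
    · simp only [h1, h2, if_false]
      push_cast; ring

/-- **the obstruction, stated on b05's index data**: along `N = 6m+3`, for the nonzero zone fibre
`p′ = sWit` and the alias class `kWit` (paired between the levels `N` and `2N`: same representative),
the order-2 free-diagonal weight `S^{(n)}((p′+2πk)_{μ₁})/Δ^{(n)}(p′+2πk)` is `4/7` at `n = N` and `2/3`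
at `n = 2N`. [folklore] -/
theorem order_two_weight_no_rate_classes (m : ℕ) {μ₁ μ₂ : Fin d} (hne : μ₁ ≠ μ₂) :
    Sxir (6 * m + 3) (shiftr (6 * m + 3) (kWit m (6 * m + 3) le_rfl μ₁ μ₂) (sWit μ₁) μ₁)
        / DeltaXir (6 * m + 3) 0 (shiftr (6 * m + 3) (kWit m (6 * m + 3) le_rfl μ₁ μ₂) (sWit μ₁))
        = 4 / 7 ∧
      Sxir (2 * (6 * m + 3))
          (shiftr (2 * (6 * m + 3)) (kWit m (2 * (6 * m + 3)) (by omega) μ₁ μ₂) (sWit μ₁) μ₁)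
        / DeltaXir (2 * (6 * m + 3)) 0
            (shiftr (2 * (6 * m + 3)) (kWit m (2 * (6 * m + 3)) (by omega) μ₁ μ₂) (sWit μ₁))
        = 2 / 3 := by
  rw [← qWit_eq_shiftr m hne, ← qWit_eq_shiftr_double m hne]
  exact ⟨weight_level (6 * m + 3) (by omega) hne, weight_level_double (6 * m + 3) (by omega) hne⟩

end Literature.MathematicalPhysics.QuantumFieldTheory.Balaban1983to89.B5G183RateObstruction
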